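import Summits.BirchSwinnertonDyer.BirchSwinnertonDyer.Theorems.ResidualThetaTransportAtTwoResidualThetaMainConjectureAtTwoEulerLayer
import Summits.BirchSwinnertonDyer.Rank1Residual.X2.EulerFactorInvariants
import HarnessLib

/-!
# Route `SignedLowerHalves`, crux L `SmallImageLowerHalfBothSigns` (item stmt-BirchSwinnertonDyer-23599), line `rtt_w3` v3,
# stub AN_W `stub_layerLambdaDepleted_ns`: the LAYER-`n` Euler factor at an ODD prime `p` has `X`-order
# `δ_W^{(v)} = s_ℓ·d_ℓ` modulo `p` (Greenberg–Vatsal Prop. (2.4) at the layers)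

LEAD `cruxlead-stmt-BirchSwinnertonDyer-23599` g0 (cell `bsd-ssimc`); ROUTE-INDEPENDENT helper (`--supports
stmt-BirchSwinnertonDyer-23599`); THEOREMS ONLY — no definition, no named fact, no `sorry`; closes nothing; BSD is not proved
by any of this.

The `S₀`-depleted Mazur–Tate element of line `rtt_w3` multiplies `θ_n(f)` by the LAYER-`n` Euler factors
`E_{v,n} = P_v(ℓ⁻¹ (X+1)^{e_{v,n}}) ∈ ℤ_p[X]`, `e_{v,n} = (−f_ℓ mod pⁿ) ∈ [0, pⁿ)` (`f_ℓ` Greenberg–Vatsal's Frobenius exponent,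
`ℓ = ω(ℓ)·(1+p)^{f_ℓ}`). This file ports the tree's `p = 2` computation `ResidualThetaLayer.order_layerEulerFactor_two` to an
odd prime `p`: for `ℓ ≠ p` and `n > v_p(f_ℓ)`, the reduction of `E_{v,n}` modulo `p` is `P̃_ℓ(ℓ̃⁻¹ (X+1)^{e_{v,n}})` with
`e_{v,n} = p^{v_p(f_ℓ)}·e′`, `p ∤ e′`, hence of `X`-order `mult_{ℓ̃⁻¹}(P̃_ℓ) · p^{v_p(f_ℓ)} = d_ℓ · s_ℓ = δ_W^{(v)}`
(`GreenbergVatsal2000.delta`; the power-series form is the tree's `EulerFactorInvariants.order_map_toZMod_eulerFactorElement`).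

* `order_coe_X_add_one_pow_sub_one` — `ord_X((X+1)^{p^t e′} − 1) = p^t` in `𝔽_p⟦X⟧` for `p ∤ e′` (Frobenius).
* `val_toZModPow_neg_frobeniusExponent` — `(−f_ℓ mod pⁿ) = p^{v_p(f_ℓ)}·e′`, `p ∤ e′`, for `n > v_p(f_ℓ)`.
* **`order_layerEulerFactor`** — `ord_X(E_{v,n} mod p) = δ_W^{(v)}`; **`order_layerEulerProduct`** — the product over a finite
  `S₀ ∌ p` has `X`-order `Σ_{v∈S₀} δ_W^{(v)}` once `n > v_p(f_ℓ)` for all `v ∈ S₀`.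

References: [GreenbergVatsal2000] §2 Prop. (2.4) (p. 22), §1 p. 9; [PollackWeston2011MT] §3.1; [Washington1997] §7.1.
-/

set_option linter.dupNamespace false
set_option autoImplicit false

noncomputable section

open scoped Classical

open Polynomial NumberField IsDedekindDomain WeierstrassCurve Literature.NumberTheory.EllipticCurves
  Literature.NumberTheory.EllipticCurves.GreenbergVatsal2000 Rat.HeightOneSpectrum
  Summit.BirchSwinnertonDyer.Rank1Residual.X2.EulerFactorAlgebra
  Summit.BirchSwinnertonDyer.Rank1Residual.X2.EulerFactorInvariants
  Summit.BirchSwinnertonDyer.BirchSwinnertonDyer.Theorems.ResidualThetaLayer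

namespace Summit.BirchSwinnertonDyer.BirchSwinnertonDyer.Theorems.SmallImageRttOneSided

variable {p : ℕ} [hp : Fact p.Prime]

/-! ## §1 Frobenius: `ord_X((X+1)^{p^t e′} − 1) = p^t` -/

section Frobenius

/-- **`ord_X((X + 1)^{p^t·e′} − 1) = p^t` in `𝔽_p⟦X⟧` for `p ∤ e′`**: `(X+1)^{e′} = 1 + e′X + …` has a unit linear coefficient,
and Frobenius (`EulerFactorAlgebra.order_pow_prime_pow_sub_one`). [cite: Washington1997, §7.1] -/
theorem order_coe_X_add_one_pow_sub_one {t e' : ℕ} (he' : ¬ p ∣ e') :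
    ((((X + 1 : (ZMod p)[X]) ^ (p ^ t * e') : (ZMod p)[X]) : PowerSeries (ZMod p)) - 1).order =
      ((p ^ t : ℕ) : ℕ∞) := by
  set H : PowerSeries (ZMod p) := (((X + 1 : (ZMod p)[X]) ^ e' : (ZMod p)[X]) : PowerSeries (ZMod p))
    with hH
  have hpow : (((X + 1 : (ZMod p)[X]) ^ (p ^ t * e') : (ZMod p)[X]) : PowerSeries (ZMod p)) = H ^ p ^ t := by
    rw [hH, ← Polynomial.coe_pow, ← pow_mul, mul_comm]
  have h0 : PowerSeries.constantCoeff H = 1 := by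
    rw [hH, ← PowerSeries.coeff_zero_eq_constantCoeff_apply, Polynomial.coeff_coe, coeff_X_add_one_pow,
      Nat.choose_zero_right, Nat.cast_one]
  have h1 : PowerSeries.coeff 1 H ≠ 0 := by
    rw [hH, Polynomial.coeff_coe, coeff_X_add_one_pow, Nat.choose_one_right, Ne, ZMod.natCast_eq_zero_iff]
    exact he'
  rw [hpow, order_pow_prime_pow_sub_one p H h0 h1 t, Nat.cast_pow]

end Frobenius

/-! ## §2 The layer-`n` Euler factor at an odd prime -/

section Layer

variable (W : WeierstrassCurve ℚ) (v : HeightOneSpectrum (𝓞 ℚ))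

/-- `v_p(−f_ℓ) = v_p(f_ℓ)`. [folklore] -/
theorem valuation_neg_frobeniusExponent :
    (-(frobeniusExponent p (natGenerator v : ℤ_[p]))).valuation =
      (frobeniusExponent p (natGenerator v : ℤ_[p])).valuation := by
  set f := frobeniusExponent p (natGenerator v : ℤ_[p]) with hfdef
  by_cases hf : f = 0
  · rw [hf, neg_zero]
  · have hm1 : ((-1 : ℤ_[p])).valuation = 0 := by
      have h := PadicInt.valuation_pow (-1 : ℤ_[p]) 2
      rw [neg_one_sq, PadicInt.valuation_one] at h
      omega
    rw [show -f = (-1) * f by ring, PadicInt.valuation_mul (by norm_num) hf, hm1, zero_add]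

/-- **The layer exponent is `p^{v_p(f_ℓ)}` times a number prime to `p`**: for `ℓ ≠ p` and `n > v_p(f_ℓ)`,
`(−f_ℓ mod pⁿ) = p^{v_p(f_ℓ)} · e′` with `p ∤ e′` (canonical representative in `[0, pⁿ)`).
[cite: GreenbergVatsal2000, §1 p. 9 (f_ℓ)] -/
theorem val_toZModPow_neg_frobeniusExponent (hℓ : natGenerator v ≠ p) {n : ℕ}
    (hn : (frobeniusExponent p (natGenerator v : ℤ_[p])).valuation < n) :
    ∃ e' : ℕ, ¬ p ∣ e' ∧
      (PadicInt.toZModPow n (-(frobeniusExponent p (natGenerator v : ℤ_[p])))).val =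
        p ^ (frobeniusExponent p (natGenerator v : ℤ_[p])).valuation * e' := by
  obtain ⟨hcop, h1⟩ := coprime_natGenerator v (p := p) hℓ
  have hf : -(frobeniusExponent p (natGenerator v : ℤ_[p])) ≠ 0 :=
    neg_ne_zero.mpr (frobeniusExponent_natCast_ne_zero hcop h1)
  have hval := valuation_neg_frobeniusExponent (p := p) v
  obtain ⟨e', he', he⟩ := val_toZModPow_eq_pow_mul hf (n := n) (by rw [hval]; exact hn)
  exact ⟨e', he', by rw [he, hval]⟩

/-- **The layer Euler factor mod `p` has `X`-order `δ_W^{(v)} = s_ℓ · d_ℓ`** (odd `p`). For a place `v = (ℓ)`, `ℓ ≠ p`, and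
`n > v_p(f_ℓ)`, the reduction mod `p` of `E_{v,n} = P_ℓ(ℓ⁻¹ (X+1)^{e_{v,n}}) ∈ ℤ_p[X]`, `e_{v,n} = (−f_ℓ mod pⁿ)`, is
`P̃_ℓ(ℓ̃⁻¹ (X+1)^{e_{v,n}})`, of `X`-order `mult_{ℓ̃⁻¹}(P̃_ℓ) · ord_X((X+1)^{e_{v,n}} − 1) = d_ℓ · p^{v_p(f_ℓ)} = d_ℓ · s_ℓ` — the
layer-`n` form of Greenberg–Vatsal Prop. (2.4) (power-series form: `EulerFactorInvariants.order_map_toZMod_eulerFactorElement`;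
`p = 2`: `ResidualThetaLayer.order_layerEulerFactor_two`). [cite: GreenbergVatsal2000, §2 Prop. (2.4) (p. 22)] -/
theorem order_layerEulerFactor (hp2 : p ≠ 2) (hℓ : natGenerator v ≠ p) {n : ℕ}
    (hn : (frobeniusExponent p (natGenerator v : ℤ_[p])).valuation < n) :
    (((((W.localPolynomialAt v).map (Int.castRingHom ℤ_[p])).comp
        (C ((natGenerator v : ℤ_[p]).inv) *
          (X + 1) ^ (PadicInt.toZModPow n
            (-(frobeniusExponent p (natGenerator v : ℤ_[p])))).val)).map
          (PadicInt.toZMod (p := p)) : (ZMod p)[X]) : PowerSeries (ZMod p)).order =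
      ((delta W p v : ℕ) : ℕ∞) := by
  obtain ⟨hcop, h1⟩ := coprime_natGenerator v (p := p) hℓ
  set t := (frobeniusExponent p (natGenerator v : ℤ_[p])).valuation with ht
  obtain ⟨e', he', he⟩ := val_toZModPow_neg_frobeniusExponent (p := p) v hℓ hn
  rw [he]
  set a : ZMod p := ((natGenerator v : ZMod p))⁻¹ with ha
  -- reduce mod p: `P̃_ℓ(ℓ̃⁻¹ (X+1)^e)`
  have hred : (((W.localPolynomialAt v).map (Int.castRingHom ℤ_[p])).comp
        (C ((natGenerator v : ℤ_[p]).inv) * (X + 1) ^ (p ^ t * e'))).map (PadicInt.toZMod (p := p)) =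
      (eulerFactorModP W p v).comp (C a * (X + 1) ^ (p ^ t * e')) := by
    rw [Polynomial.map_comp, Polynomial.map_map, RingHom.ext_int ((PadicInt.toZMod (p := p)).comp
      (Int.castRingHom ℤ_[p])) (Int.castRingHom (ZMod p)), eulerFactorModP, Polynomial.map_mul,
      Polynomial.map_C, toZMod_inv_natCast hcop, ha, Polynomial.map_pow, Polynomial.map_add, Polynomial.map_X,
      Polynomial.map_one]
  rw [hred, coe_comp_eq_aeval]
  -- `↑(C a · (X+1)^e) = C a + C a · ε`, `ε = (X+1)^e − 1`, `ε(0) = 0`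
  set ε : PowerSeries (ZMod p) :=
    (((X + 1 : (ZMod p)[X]) ^ (p ^ t * e') : (ZMod p)[X]) : PowerSeries (ZMod p)) - 1 with hεdef
  have hsplit : (((C a * (X + 1) ^ (p ^ t * e') : (ZMod p)[X])) : PowerSeries (ZMod p)) =
      PowerSeries.C a + PowerSeries.C a * ε := by
    rw [Polynomial.coe_mul, Polynomial.coe_C, hεdef]; ring
  have hε0' : PowerSeries.constantCoeff ε = 0 := by
    rw [hεdef, map_sub, ← PowerSeries.coeff_zero_eq_constantCoeff_apply, Polynomial.coeff_coe,
      coeff_X_add_one_pow, Nat.choose_zero_right, Nat.cast_one, map_one, sub_self]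
  have hε0 : PowerSeries.constantCoeff (PowerSeries.C a * ε) = 0 := by
    rw [map_mul, hε0', mul_zero]
  have hℓ0 : (natGenerator v : ZMod p) ≠ 0 := by
    rw [Ne, ZMod.natCast_eq_zero_iff]
    exact (Nat.Prime.coprime_iff_not_dvd hp.out).mp hcop
  have ha0 : a ≠ 0 := by rw [ha]; exact inv_ne_zero hℓ0
  have hεord : (PowerSeries.C a * ε).order = ((p ^ t : ℕ) : ℕ∞) := by
    rw [PowerSeries.order_mul, PowerSeries.order_zero_of_unit
      ((PowerSeries.isUnit_iff_constantCoeff).mpr (by rwa [PowerSeries.constantCoeff_C, isUnit_iff_ne_zero])),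
      zero_add, hεdef, order_coe_X_add_one_pow_sub_one he']
  rw [hsplit, order_aeval_C_add (eulerFactorModP_ne_zero W v) a hε0, hεord, delta_eq, dMultiplicity, ← ha,
    ← pow_valuation_frobeniusExponent_eq_sFactor hp2 hcop h1, ← ht, Nat.cast_mul, Nat.cast_pow, mul_comm]

/-- **The layer depletion product mod `p` has `X`-order `Σ_{v∈S₀} δ_W^{(v)}`** for a finite set `S₀` of places `≠ p` and `n`
exceeding every `v_p(f_ℓ)`, `v ∈ S₀` (orders add in the domain `𝔽_p⟦X⟧`; the layer-`n` form of Greenberg–Vatsal's display (9)).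
[cite: GreenbergVatsal2000, §1 p. 9 (display (9)) and §2 Prop. (2.4)] -/
theorem order_layerEulerProduct (hp2 : p ≠ 2) (S₀ : Finset (HeightOneSpectrum (𝓞 ℚ)))
    (hS : ∀ v ∈ S₀, natGenerator v ≠ p) {n : ℕ}
    (hn : ∀ v ∈ S₀, (frobeniusExponent p (natGenerator v : ℤ_[p])).valuation < n) :
    (((∏ v ∈ S₀, ((W.localPolynomialAt v).map (Int.castRingHom ℤ_[p])).comp
        (C ((natGenerator v : ℤ_[p]).inv) *
          (X + 1) ^ (PadicInt.toZModPow n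
            (-(frobeniusExponent p (natGenerator v : ℤ_[p])))).val)).map
          (PadicInt.toZMod (p := p)) : (ZMod p)[X]) : PowerSeries (ZMod p)).order =
      ((∑ v ∈ S₀, delta W p v : ℕ) : ℕ∞) := by
  induction S₀ using Finset.induction_on with
  | empty =>
    rw [Finset.prod_empty, Polynomial.map_one, Polynomial.coe_one, PowerSeries.order_one, Finset.sum_empty,
      Nat.cast_zero]
  | insert w S hw ih =>
    rw [Finset.prod_insert hw, Polynomial.map_mul, Polynomial.coe_mul, PowerSeries.order_mul,
      ih (fun v hv ↦ hS v (Finset.mem_insert_of_mem hv)) (fun v hv ↦ hn v (Finset.mem_insert_of_mem hv)),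
      order_layerEulerFactor W w hp2 (hS w (Finset.mem_insert_self w S)) (hn w (Finset.mem_insert_self w S)),
      Finset.sum_insert hw, Nat.cast_add]

end Layer

end Summit.BirchSwinnertonDyer.BirchSwinnertonDyer.Theorems.SmallImageRttOneSided

end
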